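import Mathlib
import Literature.Analysis.FluidPDE.TaoCascadeODE
import Literature.Barriers.NavierStokesRegularity.DyadicInvariantRegion
import HarnessLib

/-!
# The PAIR SLAVING LEMMA for Katz–Pavlović feeds — a source drained through its own feed target
(helper file for crux stmt-NavierStokesRegularity-27057 `SubOnsagerCeiling.ForwardTailCeilingKP`,
`--supports`; LEAD SOC seat ns-soc-p2, KEY-NS #146 (1): «the slaving lemma's Lean signature»)

THE MECHANISM. In a KP network proper (orthant table with diagonal feed forms; normal form
`kpProper_quadTerm`, p640757) a forward source `s = X_{a,n}` that feeds the component `e` one shell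
up through the weight `w = α a a e (0,0,1) > 0` is drained by the product with ITS OWN TARGET
`d = X_{e,n+1}` — and that target is fed by `s²` with the SAME rate `λ = w·(1+ε₀)^{5n/2}` (energy
conservation of the Katz–Pavlović pair):

  `s' ≤ I₀ − λ·s·d`,   `d' ≥ λ·s² − ρ₀·d`,   `s, d ≥ 0`,

where `I₀` bounds every OTHER input into `s` (feeds from the shell below, in-shell pumps and
differential pumps — all quadratic in amplitudes one already controls) and `ρ₀` bounds the total
drain RATE of the target (its own feeds and pumps times the amplitudes of ITS partners, plus
viscosity). The pair then SLAVES `s`: whatever the size of the uncontrolled partner `d` (a dead-end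
pocket may grow without bound in weighted units — the 25507 witness α_SB), `s` never exceeds

  `S ≍ max((I₀ρ₀)^{1/3} λ^{-2/3}, (I₀/λ)^{1/2})`     (`pairSlaving_exists`, `pairSlaving_lt`).

In Kolmogorov units at shell `n` (`λ ≍ Λ_n`, `I₀ ≍ Λ_n A_n²`, `ρ₀ ≍ Λ_{n+1} A_{n+1}`) both terms are
`≍ A_n = Λ_n^{-1/3}`; in front units (`I₀ ≍ Λ_n F_n²`, `ρ₀ ≍ Λ F`) both are `≍ F_n`: the bound is
scale-covariant, so a secondary source inherits whatever envelope its feeders and its target's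
partners obey. With the crude energy bound `ρ₀ ≤ R Λ_{n+1} √(2E₀)` alone the first term degrades a
front exponent `θ_f` to `2θ_f/3` (still `> 1/2` iff `θ_f > 3/4`).

PROOF (invariant region, no case analysis at a kink). With `ψ(u) = (u³ − S³/8)/3` (a cubic that is
`≤ 0` on `[0, S/2]`, so the constraint is void there, and has `ψ' = u² ≥ 0`) the quantity
`Q = d − c·ψ(s)` obeys `Q' + ρ₀ Q ≥ s²(λ − cI₀ − cρ₀S/3) ≥ 0` as long as `s ≤ S`; hence at the first
time `t₂` with `s(t₂) = S` one has `d(t₂) ≥ 7cS³/24` and `s'(t₂) ≤ I₀ − 7cλS⁴/24 < 0`, contradicting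
the approach from below. Constants: `c(I₀ + ρ₀S/3) ≤ λ` and `24 I₀ < 7cλS⁴`, solvable iff
`24 I₀² + 8 I₀ρ₀S < 7 λ²S⁴`.

CONTENTS. §1 `pairSlaving_lt` (abstract ODE lemma, explicit `c`), `pairSlaving_exists_const`,
`pairSlaving_of_lt` (the closed form above); §2 `kpProper_pairSlaving` — the same along an honest
viscous lattice solution (`HasDerivWithinAt` of `X_{a,n}`, `X_{e,n+1}` with right-hand sides
`quadTerm − ν(1+ε₀)^{2k}X`), the two structural inequalities on `quadTerm` being the hypotheses
`hIn` / `hOut` that the normal form `kpProper_quadTerm` discharges table by table.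

HONEST FRAMING: an ODE comparison lemma about Tao-type MODEL lattice tables (rung TL-M2Break, route
SubOnsagerCeiling); it bounds ONE source given bounds on its neighbours — it is an ingredient of,
not a proof of, the crux `ForwardTailCeilingKP`; nothing here bears on Navier–Stokes regularity.
-/

noncomputable section

-- the sub-problem namespace `NavierStokesRegularity.NavierStokesRegularity` is the tree's layout (D-0017)
set_option linter.dupNamespace false

namespace Summit.NavierStokesRegularity.NavierStokesRegularity.Theorems

open Set Filter Topology
open Literature.Analysis.FluidPDE.TaoCascade

/-! ## §1 The abstract pair slaving lemma -/

/-- **PAIR SLAVING LEMMA (explicit constants).** On `[t₀, t₁]` let `s, d ≥ 0` satisfy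
`s' ≤ I₀ − λ s d` and `d' ≥ λ s² − ρ₀ d` (`λ > 0`, `ρ₀ ≥ 0`), and let `S > 0`, `c > 0` with
`c·I₀ + c·ρ₀·S/3 ≤ λ` and `24·I₀ < 7·c·λ·S⁴`. If `s(t₀) ≤ S/2` then `s < S` on all of `[t₀, t₁]`.
[folklore ODE comparison (invariant region `{s ≤ S, d ≥ c(s³ − S³/8)/3}`); this file] -/
theorem pairSlaving_lt {s d s' d' : ℝ → ℝ} {t₀ t₁ lam I₀ ρ₀ S c : ℝ}
    (hlam : 0 < lam) (hρ : 0 ≤ ρ₀) (hS : 0 < S) (hc : 0 < c)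
    (hca : c * I₀ + c * ρ₀ * S / 3 ≤ lam) (hcb : 24 * I₀ < 7 * c * lam * S ^ 4)
    (hsd : ∀ t ∈ Icc t₀ t₁, HasDerivWithinAt s (s' t) (Icc t₀ t₁) t)
    (hdd : ∀ t ∈ Icc t₀ t₁, HasDerivWithinAt d (d' t) (Icc t₀ t₁) t)
    (hs0 : ∀ t ∈ Icc t₀ t₁, 0 ≤ s t) (hd0 : ∀ t ∈ Icc t₀ t₁, 0 ≤ d t)
    (hs' : ∀ t ∈ Icc t₀ t₁, s' t ≤ I₀ - lam * s t * d t)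
    (hd' : ∀ t ∈ Icc t₀ t₁, lam * s t ^ 2 - ρ₀ * d t ≤ d' t)
    (hinit : s t₀ ≤ S / 2) :
    ∀ t ∈ Icc t₀ t₁, s t < S := by
  have hscont : ContinuousOn s (Icc t₀ t₁) := fun t ht => (hsd t ht).continuousWithinAt
  have hdcont : ContinuousOn d (Icc t₀ t₁) := fun t ht => (hdd t ht).continuousWithinAt
  by_contra hcon
  push Not at hcon
  obtain ⟨tb, htb, hStb⟩ := hcon
  -- the first time the level `S` is reached
  set A : Set ℝ := Icc t₀ t₁ ∩ s ⁻¹' (Ici S) with hA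
  have hAc : IsClosed A := hscont.preimage_isClosed_of_isClosed isClosed_Icc isClosed_Ici
  have hAne : A.Nonempty := ⟨tb, htb, hStb⟩
  have hAbdd : BddBelow A := ⟨t₀, fun t ht => ht.1.1⟩
  set t₂ := sInf A with ht₂
  have ht₂A : t₂ ∈ A := hAc.csInf_mem hAne hAbdd
  have ht₂I : t₂ ∈ Icc t₀ t₁ := ht₂A.1
  have hSle : S ≤ s t₂ := ht₂A.2
  have hbefore : ∀ t ∈ Icc t₀ t₁, t < t₂ → s t < S := by
    intro t ht hlt
    by_contra h
    push Not at h
    have : t₂ ≤ t := csInf_le hAbdd ⟨ht, h⟩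
    linarith
  have ht₀₂ : t₀ < t₂ := by
    rcases eq_or_lt_of_le ht₂I.1 with h | h
    · rw [← h] at hSle; linarith
    · exact h
  -- `s t₂ = S` (closed constraint from the left)
  have hseq : s t₂ = S := by
    refine le_antisymm ?_ hSle
    have := Literature.Barriers.NavierStokesRegularity.Dyadic.le_of_forall_Ico_le
      (f := s) (g := fun _ => S) hscont continuousOn_const ⟨ht₀₂, ht₂I.2⟩
      (fun u hu => (hbefore u ⟨hu.1, hu.2.le.trans ht₂I.2⟩ hu.2).le)
    exact this
  have hsle : ∀ t ∈ Icc t₀ t₂, s t ≤ S := by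
    intro t ht
    rcases lt_or_eq_of_le ht.2 with h | h
    · exact (hbefore t ⟨ht.1, h.le.trans ht₂I.2⟩ h).le
    · rw [h, hseq]
  -- the Lyapunov-type quantity `G = exp(ρ₀ t) · (d − c ψ(s))`, `ψ(u) = (u³ − S³/8)/3`
  set Q : ℝ → ℝ := fun t => d t - c * ((s t) ^ 3 - S ^ 3 / 8) / 3 with hQ
  set Q' : ℝ → ℝ := fun t => d' t - c * (s t) ^ 2 * s' t with hQ'
  set G : ℝ → ℝ := fun t => Real.exp (ρ₀ * t) * Q t with hG
  set G' : ℝ → ℝ := fun t => ρ₀ * Real.exp (ρ₀ * t) * Q t + Real.exp (ρ₀ * t) * Q' t with hG'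
  have hQd : ∀ t ∈ Icc t₀ t₁, HasDerivWithinAt Q (Q' t) (Icc t₀ t₁) t := by
    intro t ht
    have h3 : HasDerivWithinAt (fun u => (s u) ^ 3) ((3 : ℕ) * (s t) ^ (3 - 1) * s' t) (Icc t₀ t₁) t :=
      (hsd t ht).pow 3
    have h4 : HasDerivWithinAt (fun u => c * ((s u) ^ 3 - S ^ 3 / 8) / 3)
        (c * ((3 : ℕ) * (s t) ^ (3 - 1) * s' t - 0) / 3) (Icc t₀ t₁) t :=
      ((h3.sub (hasDerivWithinAt_const t (Icc t₀ t₁) (S ^ 3 / 8))).const_mul c).div_const 3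
    have h5 := (hdd t ht).sub h4
    refine h5.congr_deriv ?_
    simp only [hQ']
    push_cast
    ring
  have hGd : ∀ t ∈ Icc t₀ t₁, HasDerivWithinAt G (G' t) (Icc t₀ t₁) t := by
    intro t ht
    have he : HasDerivWithinAt (fun u => Real.exp (ρ₀ * u)) (Real.exp (ρ₀ * t) * ρ₀) (Icc t₀ t₁) t := by
      have := ((hasDerivAt_id t).const_mul ρ₀).exp
      simpa using this.hasDerivWithinAt
    have := he.mul (hQd t ht)
    refine this.congr_deriv ?_
    simp only [hG']
    ring
  -- the field points inward: `Q' + ρ₀ Q ≥ 0` while `s ≤ S`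
  have hG'pos : ∀ t ∈ Icc t₀ t₂, 0 ≤ G' t := by
    intro t ht
    have ht' : t ∈ Icc t₀ t₁ := ⟨ht.1, ht.2.trans ht₂I.2⟩
    have hs_le : s t ≤ S := hsle t ht
    have hs_nn : 0 ≤ s t := hs0 t ht'
    have hd_nn : 0 ≤ d t := hd0 t ht'
    have h1 : s' t ≤ I₀ := by
      have := hs' t ht'
      nlinarith [mul_nonneg (mul_nonneg hlam.le hs_nn) hd_nn]
    have h2 := hd' t ht'
    have hkey : 0 ≤ Q' t + ρ₀ * Q t := by
      simp only [hQ, hQ']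
      -- `d' - c s² s' + ρ₀ d - ρ₀ c (s³ - S³/8)/3 ≥ s² (λ - c I₀ - c ρ₀ S/3) ≥ 0`
      have h3 : c * s t ^ 2 * s' t ≤ c * s t ^ 2 * I₀ :=
        mul_le_mul_of_nonneg_left h1 (by positivity)
      have h4 : ρ₀ * (c * (s t ^ 3 - S ^ 3 / 8) / 3) ≤ ρ₀ * c * S * s t ^ 2 / 3 := by
        have : s t ^ 3 - S ^ 3 / 8 ≤ S * s t ^ 2 := by nlinarith [pow_pos hS 3]
        have := mul_le_mul_of_nonneg_left this (mul_nonneg hρ hc.le)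
        nlinarith
      have h5 : 0 ≤ s t ^ 2 * (lam - c * I₀ - c * ρ₀ * S / 3) :=
        mul_nonneg (pow_nonneg hs_nn 2) (by linarith)
      nlinarith
    have hexp : 0 < Real.exp (ρ₀ * t) := Real.exp_pos _
    simp only [hG']
    have : G' t = Real.exp (ρ₀ * t) * (Q' t + ρ₀ * Q t) := by simp only [hG']; ring
    nlinarith [mul_nonneg hexp.le hkey]
  -- `G` is monotone on `[t₀, t₂]`
  have hGmono : MonotoneOn G (Icc t₀ t₂) := by
    have hGcont : ContinuousOn G (Icc t₀ t₂) := fun t ht =>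
      ((hGd t ⟨ht.1, ht.2.trans ht₂I.2⟩).continuousWithinAt).mono (Icc_subset_Icc_right ht₂I.2)
    refine monotoneOn_of_hasDerivWithinAt_nonneg (f' := G') (convex_Icc t₀ t₂) hGcont ?_ ?_
    · intro x hx
      rw [interior_Icc] at hx ⊢
      have hx' : x ∈ Icc t₀ t₁ := ⟨hx.1.le, hx.2.le.trans ht₂I.2⟩
      exact (hGd x hx').mono (Ioo_subset_Icc_self.trans (Icc_subset_Icc_right ht₂I.2))
    · intro x hx
      rw [interior_Icc] at hx
      exact hG'pos x ⟨hx.1.le, hx.2.le⟩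
  have hG0 : 0 ≤ G t₀ := by
    have hs3 : s t₀ ^ 3 ≤ S ^ 3 / 8 := by
      have h0 : 0 ≤ s t₀ := hs0 t₀ ⟨le_rfl, ht₀₂.le.trans ht₂I.2⟩
      have : s t₀ ^ 3 ≤ (S / 2) ^ 3 := pow_le_pow_left₀ h0 hinit 3
      nlinarith
    have hQ0 : 0 ≤ Q t₀ := by
      simp only [hQ]
      have := hd0 t₀ ⟨le_rfl, ht₀₂.le.trans ht₂I.2⟩
      nlinarith
    simp only [hG]
    exact mul_nonneg (Real.exp_pos _).le hQ0
  have hG2 : 0 ≤ G t₂ :=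
    hG0.trans (hGmono ⟨le_rfl, ht₀₂.le⟩ ⟨ht₀₂.le, le_rfl⟩ ht₀₂.le)
  have hQ2 : 0 ≤ Q t₂ := by
    have hexp : 0 < Real.exp (ρ₀ * t₂) := Real.exp_pos _
    simp only [hG] at hG2
    by_contra hh
    push Not at hh
    nlinarith [mul_pos hexp (neg_pos.2 hh)]
  have hd2 : 7 * c * S ^ 3 / 24 ≤ d t₂ := by
    simp only [hQ, hseq] at hQ2
    nlinarith
  -- at `t₂` the derivative of `s` is negative …
  have hneg : s' t₂ < 0 := by
    have h := hs' t₂ ht₂I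
    rw [hseq] at h
    have : lam * S * (7 * c * S ^ 3 / 24) ≤ lam * S * d t₂ :=
      mul_le_mul_of_nonneg_left hd2 (by positivity)
    nlinarith
  -- … but `s` approaches `S` from below: contradiction via the left slopes
  have hder : HasDerivWithinAt s (s' t₂) (Ico t₀ t₂) t₂ :=
    (hsd t₂ ht₂I).mono fun u hu => ⟨hu.1, hu.2.le.trans ht₂I.2⟩
  rw [hasDerivWithinAt_iff_tendsto_slope' (by simp)] at hder
  have hev : ∀ᶠ u in 𝓝[Ico t₀ t₂] t₂, slope s t₂ u < 0 := hder.eventually_lt_const hneg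
  have hne : (𝓝[Ico t₀ t₂] t₂).NeBot := by
    refine mem_closure_iff_nhdsWithin_neBot.1 ?_
    rw [closure_Ico ht₀₂.ne]
    exact right_mem_Icc.2 ht₀₂.le
  obtain ⟨u, hu, huI⟩ := (hev.and self_mem_nhdsWithin).exists
  have hult : u < t₂ := huI.2
  rw [slope_def_field] at hu
  have hsu : s u < S := hbefore u ⟨huI.1, hult.le.trans ht₂I.2⟩ hult
  have hnum : 0 < s u - s t₂ := by
    have hden : u - t₂ < 0 := by linarith
    by_contra hh
    push Not at hh
    have : 0 ≤ (s u - s t₂) / (u - t₂) := div_nonneg_of_nonpos hh hden.le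
    linarith
  linarith

/-- **Choice of the region constant.** If `24 I₀² + 8 I₀ ρ₀ S < 7 λ² S⁴` then some `c > 0` satisfies
the two conditions of `pairSlaving_lt`. [this file] -/
theorem pairSlaving_exists_const {lam I₀ ρ₀ S : ℝ} (hlam : 0 < lam) (hI : 0 ≤ I₀) (hρ : 0 ≤ ρ₀)
    (hS : 0 < S) (hcond : 24 * I₀ ^ 2 + 8 * I₀ * ρ₀ * S < 7 * lam ^ 2 * S ^ 4) :
    ∃ c : ℝ, 0 < c ∧ c * I₀ + c * ρ₀ * S / 3 ≤ lam ∧ 24 * I₀ < 7 * c * lam * S ^ 4 := by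
  by_cases hden : I₀ + ρ₀ * S / 3 = 0
  · have hI0 : I₀ = 0 := by nlinarith [mul_nonneg hρ hS.le]
    have hρS : ρ₀ * S = 0 := by nlinarith
    refine ⟨1, one_pos, ?_, ?_⟩
    · nlinarith
    · rw [hI0]; nlinarith [pow_pos hS 4]
  · have hpos : 0 < I₀ + ρ₀ * S / 3 :=
      lt_of_le_of_ne (by positivity) (Ne.symm hden)
    refine ⟨lam / (I₀ + ρ₀ * S / 3), div_pos hlam hpos, ?_, ?_⟩
    · rw [show lam / (I₀ + ρ₀ * S / 3) * I₀ + lam / (I₀ + ρ₀ * S / 3) * ρ₀ * S / 3 =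
          lam / (I₀ + ρ₀ * S / 3) * (I₀ + ρ₀ * S / 3) by ring, div_mul_cancel₀ _ hden]
    · rw [show 7 * (lam / (I₀ + ρ₀ * S / 3)) * lam * S ^ 4 = (7 * lam ^ 2 * S ^ 4) / (I₀ + ρ₀ * S / 3) by
          ring, lt_div_iff₀ hpos]
      nlinarith

/-- **PAIR SLAVING LEMMA (closed form).** Under `24 I₀² + 8 I₀ ρ₀ S < 7 λ² S⁴` — i.e. for every
`S` beyond `≍ max((I₀ρ₀)^{1/3}λ^{-2/3}, (I₀/λ)^{1/2})` — a source with `s(t₀) ≤ S/2`, `s' ≤ I₀ − λ s d`,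
whose target obeys `d' ≥ λ s² − ρ₀ d`, stays `< S`. [this file] -/
theorem pairSlaving_of_lt {s d s' d' : ℝ → ℝ} {t₀ t₁ lam I₀ ρ₀ S : ℝ}
    (hlam : 0 < lam) (hI : 0 ≤ I₀) (hρ : 0 ≤ ρ₀) (hS : 0 < S)
    (hcond : 24 * I₀ ^ 2 + 8 * I₀ * ρ₀ * S < 7 * lam ^ 2 * S ^ 4)
    (hsd : ∀ t ∈ Icc t₀ t₁, HasDerivWithinAt s (s' t) (Icc t₀ t₁) t)
    (hdd : ∀ t ∈ Icc t₀ t₁, HasDerivWithinAt d (d' t) (Icc t₀ t₁) t)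
    (hs0 : ∀ t ∈ Icc t₀ t₁, 0 ≤ s t) (hd0 : ∀ t ∈ Icc t₀ t₁, 0 ≤ d t)
    (hs' : ∀ t ∈ Icc t₀ t₁, s' t ≤ I₀ - lam * s t * d t)
    (hd' : ∀ t ∈ Icc t₀ t₁, lam * s t ^ 2 - ρ₀ * d t ≤ d' t)
    (hinit : s t₀ ≤ S / 2) :
    ∀ t ∈ Icc t₀ t₁, s t < S := by
  obtain ⟨c, hc, hca, hcb⟩ := pairSlaving_exists_const hlam hI hρ hS hcond
  exact pairSlaving_lt hlam hρ hS hc hca hcb hsd hdd hs0 hd0 hs' hd' hinit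

/-! ## §2 The lattice form: a Katz–Pavlović feed pair inside an honest viscous solution -/

/-- **PAIR SLAVING ALONG A VISCOUS LATTICE SOLUTION.** Let `X` solve the `ν`-viscous lattice of the
table `α` on `[0, T]` (`HasDerivWithinAt` with right-hand side `quadTerm − ν(1+ε₀)^{2k}X`), let the
component `a` feed the component `e` one shell up with weight `w = α a a e (0,0,1) > 0`, and put
`λ = w (1+ε₀)^{5n/2}`. Suppose on `[0, T]`: `X_{a,n}, X_{e,n+1} ≥ 0`; the STRUCTURAL inequalities
`quadTerm_a(n) ≤ I₀ − λ X_{a,n} X_{e,n+1}` (every other input into `X_{a,n}` is `≤ I₀`, every other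
term a drain) and `quadTerm_e(n+1) ≥ λ X_{a,n}² − ρ₀ X_{e,n+1}` (every other input into the target is
`≥ 0`, its drains have total rate `≤ ρ₀`) — both read off the normal form `kpProper_quadTerm` of a
KP network proper; and `24 I₀² + 8 I₀ (ρ₀ + ν(1+ε₀)^{2(n+1)}) S < 7 λ² S⁴`, `X_{a,n}(0) ≤ S/2`.
Then `X_{a,n} < S` on `[0, T]`. MODEL lattice statement. [this file] -/
theorem kpProper_pairSlaving {ε₀ ν T I₀ ρ₀ S : ℝ} {α : Fin 4 → Fin 4 → Fin 4 → ℤ × ℤ × ℤ → ℝ}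
    {X : Fin 4 → ℤ → ℝ → ℝ} (hε : 0 < ε₀) (hν : 0 ≤ ν) (a e : Fin 4) (n : ℤ)
    (hXa : ∀ t ∈ Icc 0 T, HasDerivWithinAt (X a n)
      (quadTerm ε₀ α X a n t - ν * (1 + ε₀) ^ ((2 : ℝ) * n) * X a n t) (Icc 0 T) t)
    (hXe : ∀ t ∈ Icc 0 T, HasDerivWithinAt (X e (n + 1))
      (quadTerm ε₀ α X e (n + 1) t - ν * (1 + ε₀) ^ ((2 : ℝ) * (((n + 1 : ℤ)) : ℝ)) * X e (n + 1) t)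
        (Icc 0 T) t)
    (ha0 : ∀ t ∈ Icc 0 T, 0 ≤ X a n t) (he0 : ∀ t ∈ Icc 0 T, 0 ≤ X e (n + 1) t)
    (hw : 0 < α a a e (0, 0, 1)) (hI : 0 ≤ I₀) (hρ : 0 ≤ ρ₀) (hS : 0 < S)
    (hIn : ∀ t ∈ Icc 0 T, quadTerm ε₀ α X a n t ≤
      I₀ - α a a e (0, 0, 1) * (1 + ε₀) ^ ((5 : ℝ) * n / 2) * X a n t * X e (n + 1) t)
    (hOut : ∀ t ∈ Icc 0 T, α a a e (0, 0, 1) * (1 + ε₀) ^ ((5 : ℝ) * n / 2) * X a n t ^ 2 -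
      ρ₀ * X e (n + 1) t ≤ quadTerm ε₀ α X e (n + 1) t)
    (hcond : 24 * I₀ ^ 2 + 8 * I₀ * (ρ₀ + ν * (1 + ε₀) ^ ((2 : ℝ) * (((n + 1 : ℤ)) : ℝ))) * S <
      7 * (α a a e (0, 0, 1) * (1 + ε₀) ^ ((5 : ℝ) * n / 2)) ^ 2 * S ^ 4)
    (hinit : X a n 0 ≤ S / 2) :
    ∀ t ∈ Icc 0 T, X a n t < S := by
  set lam : ℝ := α a a e (0, 0, 1) * (1 + ε₀) ^ ((5 : ℝ) * n / 2) with hlam_def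
  have hb : (0 : ℝ) < 1 + ε₀ := by linarith
  have hlam : 0 < lam := mul_pos hw (Real.rpow_pos_of_pos hb _)
  have hνn : 0 ≤ ν * (1 + ε₀) ^ ((2 : ℝ) * n) := mul_nonneg hν (Real.rpow_pos_of_pos hb _).le
  have hνn1 : 0 ≤ ν * (1 + ε₀) ^ ((2 : ℝ) * (((n + 1 : ℤ)) : ℝ)) :=
    mul_nonneg hν (Real.rpow_pos_of_pos hb _).le
  refine pairSlaving_of_lt (s := X a n) (d := X e (n + 1))
    (s' := fun t => quadTerm ε₀ α X a n t - ν * (1 + ε₀) ^ ((2 : ℝ) * n) * X a n t)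
    (d' := fun t => quadTerm ε₀ α X e (n + 1) t -
      ν * (1 + ε₀) ^ ((2 : ℝ) * (((n + 1 : ℤ)) : ℝ)) * X e (n + 1) t)
    (ρ₀ := ρ₀ + ν * (1 + ε₀) ^ ((2 : ℝ) * (((n + 1 : ℤ)) : ℝ)))
    hlam hI (add_nonneg hρ hνn1) hS hcond hXa hXe ha0 he0 ?_ ?_ hinit
  · intro t ht
    have h1 := hIn t ht
    have h2 : 0 ≤ ν * (1 + ε₀) ^ ((2 : ℝ) * n) * X a n t := mul_nonneg hνn (ha0 t ht)
    simp only [hlam_def]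
    linarith
  · intro t ht
    have h1 := hOut t ht
    simp only [hlam_def]
    linarith

end Summit.NavierStokesRegularity.NavierStokesRegularity.Theorems

end
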